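import Summits.BirchSwinnertonDyer.BirchSwinnertonDyer.Theorems.TwinAlgMuZeroAtThree.Negative.Habitat
import HarnessLib

/-!
# `UniversalToricDescent.TwinAlgMuZeroAtThree` (stmt-BirchSwinnertonDyer-24737), negative-side
# support II: the bucket-C₀ HABITAT of the hypotheses (this file does NOT refute the crux)

Companion of `Negative/Habitat.lean` (bucket B, `15a1`): here the good-SUPERSINGULAR branch of the
crux's bucket guard (`GoodSS E' 3 ∧ a₃(E') = 0`).

* §3 the integer model `17a1 = [1,−1,1,−1,−14]`: `N = 17`, `Δ = −17⁴`, `#Ẽ(𝔽₃) = 4` so `a₃ = 0`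
  (good supersingular at `3`), `ρ̄₃` ONTO by the Frobenius witnesses `ℓ = 5` (irreducible) and
  `ℓ = 19` (order `3`); with `K` of discriminant `−35` (Heegner for `51 = 3·17`, hence for `17`, `3`
  split, odd): `exists_bucketC0_antecedents` — every hypothesis of `TwinAlgMuZeroAtThree` other than
  the binder `Dt'` holds simultaneously, in the kernel. CONSEQUENCE: the crux is not vacuous on its
  supersingular branch either; a proof must produce `Λ`-torsion and `μ = 0` of the signed/primitive
  `X_{∅,0}(17a1/K_∞)` at `p = 3` — not in print (`a_p = 0` results of Castella–Wan / [BCS2024 =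
  arXiv:2405.00270] assume `p ≥ 5` or good ordinary).

No new definition; no statement of the route is asserted positively. Disprover seat
`cdisprove-stmt-BirchSwinnertonDyer-24737-g0` (refuter lineage), 2026-08-29.

References: [CremonaAlgorithms1997] Table 1 (curve 17a1); [SilvermanAEC2009] VII.1 Rem. 1.1, VII.5
Prop. 5.1; [Silverman1994] IV.10.2; [Serre1972] §2.4 Prop. 15, §2.8 Prop. 19; [Marcus1977] Ch. 2
Thm. 1, Ch. 3 Thm. 25; [GrossLMS1991] §1; [IrelandRosen1990] §8.1.
-/

noncomputable section

open scoped Classical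

-- D-0017: single-problem summit, so `Summit.BirchSwinnertonDyer.BirchSwinnertonDyer.…` repeats a
-- namespace BY DESIGN.
set_option linter.dupNamespace false

namespace Summit.BirchSwinnertonDyer.BirchSwinnertonDyer.Theorems.TwinAlgMuZeroAtThree.Negative

open WeierstrassCurve NumberField IsDedekindDomain
open Literature.NumberTheory.EllipticCurves Literature.NumberTheory.EllipticCurves.Rank1Residual
open Literature.NumberTheory.EllipticCurves.ModularForms (ModularParametrizationData
  nonempty_modularParametrizationData)
open Literature.NumberTheory.EllipticCurves.BurungaleSkinner2023 (conductorNorm_baseChange_int_of_isCoprime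
  hasMultiplicativeReductionAtPrime_baseChange_int_of_isCoprime
  hasGoodReductionAtPrime_baseChange_int_of_not_dvd)
open Literature.NumberTheory.EllipticCurves.Rank1Residual.X11RankOneCertificates (countPoints)
open Summit.BirchSwinnertonDyer.BirchSwinnertonDyer.Rank1Residual (IntModel.integralModelInt_eq_of_map_eq
  IntModel.minimalDiscriminantInt_eq IntModel.frobeniusTrace_eq IntModel.padicValInt_eq_of_dvd_of_not_dvd)
open Summit.BirchSwinnertonDyer.Rank1Residual.X11b
open Summit.BirchSwinnertonDyer.Rank1Residual.GaloisImage

/-! ### §3 The integer model `17a1 = [1, −1, 1, −1, −14]` (bucket C₀ at `p = 3`) and its habitat -/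

/-- `Δ(17a1) = −83521 = −17⁴`. [cite: CremonaAlgorithms1997, Table 1 (curve 17a1)] -/
theorem M17_Δ : (⟨1, -1, 1, -1, -14⟩ : WeierstrassCurve ℤ).Δ = -83521 := by
  norm_num [WeierstrassCurve.Δ, WeierstrassCurve.b₂, WeierstrassCurve.b₄, WeierstrassCurve.b₆,
    WeierstrassCurve.b₈]

/-- `c₄(17a1) = 33`. [cite: CremonaAlgorithms1997, Table 1 (curve 17a1)] -/
theorem M17_c₄ : (⟨1, -1, 1, -1, -14⟩ : WeierstrassCurve ℤ).c₄ = 33 := by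
  norm_num [WeierstrassCurve.c₄, WeierstrassCurve.b₂, WeierstrassCurve.b₄]

/-- `Δ(17a1)` and `c₄(17a1)` are coprime (semistable). [cite: SilvermanAEC2009, VII.5 Prop. 5.1(b)] -/
theorem M17_coprime : IsCoprime (⟨1, -1, 1, -1, -14⟩ : WeierstrassCurve ℤ).Δ
    (⟨1, -1, 1, -1, -14⟩ : WeierstrassCurve ℤ).c₄ := by
  rw [M17_Δ, M17_c₄, Int.isCoprime_iff_gcd_eq_one]; decide

/-- `17a1` is an elliptic curve. [cite: CremonaAlgorithms1997, Table 1 (curve 17a1)] -/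
theorem isElliptic_17a1 : ((⟨1, -1, 1, -1, -14⟩ : WeierstrassCurve ℤ).baseChange ℚ).IsElliptic :=
  Literature.NumberTheory.EllipticCurves.isElliptic_baseChange_int _ (by rw [M17_Δ]; decide)

/-- Cremona's model `17a1` is globally minimal (`|Δ| < 3¹²`, `Δ` odd).
[cite: SilvermanAEC2009, VII.1 Remark 1.1] -/
theorem isGloballyMinimal_17a1 :
    ((⟨1, -1, 1, -1, -14⟩ : WeierstrassCurve ℤ).baseChange ℚ).IsGloballyMinimal :=
  isGloballyMinimal_baseChange_int _ (forall_not_pow_dvd_or_of_bound _ (B := 3)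
    (by rw [M17_Δ]; decide) (by rw [M17_Δ]; decide) (by
      intro p hp hpr
      have hp3 : p < 3 := Finset.mem_range.mp hp
      interval_cases p
      · exact absurd hpr (by decide)
      · exact absurd hpr (by decide)
      · left; rw [M17_Δ]; decide))

/-- The tree's integral model of `17a1 ⊗ ℚ` is the integer equation itself. [folklore] -/
theorem integralModelInt_17a1 [((⟨1, -1, 1, -1, -14⟩ : WeierstrassCurve ℤ).baseChange ℚ).IsGloballyMinimal] :
    integralModelInt ((⟨1, -1, 1, -1, -14⟩ : WeierstrassCurve ℤ).baseChange ℚ) =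
      (⟨1, -1, 1, -1, -14⟩ : WeierstrassCurve ℤ) :=
  IntModel.integralModelInt_eq_of_map_eq _ (baseChange_int_eq_map _).symm

/-- **The conductor of `17a1` is `17`.** [cite: CremonaAlgorithms1997, Table 1 (curve 17a1)] -/
theorem conductorNorm_17a1 : ((⟨1, -1, 1, -1, -14⟩ : WeierstrassCurve ℤ).baseChange ℚ).conductorNorm ℤ = 17 := by
  haveI := isElliptic_17a1
  refine conductorNorm_baseChange_int_of_isCoprime _ M17_coprime (k := 4) ?_ ?_ ?_
  · decide +kernel
  · rw [M17_Δ]; decide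
  · rw [M17_Δ]; decide

/-- `#Ẽ(𝔽₃) = 4` for `17a1` (`a₃ = 0`). [cite: IrelandRosen1990, Prop. 5.1.2 and §8.1] -/
theorem card_17a1_mod3 :
    Nat.card (((⟨1, -1, 1, -1, -14⟩ : WeierstrassCurve ℤ).map (Int.castRingHom (ZMod 3))).toAffine.Point) = 4 := by
  have h := natCard_point_eq_countPoints 1 (-1) 1 (-1) (-14) 3 (by norm_num) (by rw [M17_Δ]; decide)
  have h' : countPoints [1, -1, 1, -1, -14] 3 = 4 := by decide +kernel
  exact_mod_cast h.trans h'

/-- `#Ẽ(𝔽₅) = 8` for `17a1` (`a₅ = −2`). [cite: IrelandRosen1990, Prop. 5.1.2 and §8.1] -/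
theorem card_17a1_mod5 [Fact (Nat.Prime 5)] :
    Nat.card (((⟨1, -1, 1, -1, -14⟩ : WeierstrassCurve ℤ).map (Int.castRingHom (ZMod 5))).toAffine.Point) = 8 := by
  have h := natCard_point_eq_countPoints 1 (-1) 1 (-1) (-14) 5 (by norm_num) (by rw [M17_Δ]; decide)
  have h' : countPoints [1, -1, 1, -1, -14] 5 = 8 := by decide +kernel
  exact_mod_cast h.trans h'

/-- `#Ẽ(𝔽₁₉) = 24` for `17a1` (`a₁₉ = −4`). [cite: IrelandRosen1990, Prop. 5.1.2 and §8.1] -/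
theorem card_17a1_mod19 [Fact (Nat.Prime 19)] :
    Nat.card (((⟨1, -1, 1, -1, -14⟩ : WeierstrassCurve ℤ).map (Int.castRingHom (ZMod 19))).toAffine.Point) = 24 := by
  have h := natCard_point_eq_countPoints 1 (-1) 1 (-1) (-14) 19 (by norm_num) (by rw [M17_Δ]; decide)
  have h' : countPoints [1, -1, 1, -1, -14] 19 = 24 := by decide +kernel
  exact_mod_cast h.trans h'

/-- **`17a1` is good SUPERSINGULAR at `3` with `a₃ = 0`** (`3 ∤ Δ = −17⁴`, `#Ẽ(𝔽₃) = 4`): the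
bucket-C₀ guard. [cite: SilvermanAEC2009, VII.5 Prop. 5.1(a)] -/
theorem goodSS_three_17a1 :
    haveI := isGloballyMinimal_17a1
    GoodSS ((⟨1, -1, 1, -1, -14⟩ : WeierstrassCurve ℤ).baseChange ℚ) 3 ∧
      ((⟨1, -1, 1, -1, -14⟩ : WeierstrassCurve ℤ).baseChange ℚ).frobeniusTrace 3 = 0 := by
  haveI := isElliptic_17a1
  haveI := isGloballyMinimal_17a1
  have ha : ((⟨1, -1, 1, -1, -14⟩ : WeierstrassCurve ℤ).baseChange ℚ).frobeniusTrace 3 = 0 := by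
    rw [IntModel.frobeniusTrace_eq integralModelInt_17a1 card_17a1_mod3]; norm_num
  exact ⟨⟨hasGoodReductionAtPrime_baseChange_int_of_not_dvd _ (by rw [M17_Δ]; decide),
    by rw [ha]; exact dvd_zero _⟩, ha⟩

/-- **`ρ̄_{17a1,3}` is ONTO `GL₂(𝔽₃)`** (kernel): irreducible by `ℓ₁ = 5` (`a₅ = −2`, `X² + 2X + 5`
has no root mod `3`); an element of order `3` by `ℓ₂ = 19` (`ℓ₂ ≡ 1`, `a₁₉ = −4 ≡ 2 (mod 3)`,
`9 ∤ 24 = #Ẽ(𝔽₁₉)`). [cite: Serre1972, §2.4 Prop. 15, §2.8 Prop. 19] -/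
theorem surj_three_17a1 : ((⟨1, -1, 1, -1, -14⟩ : WeierstrassCurve ℤ).baseChange ℚ).HasSurjectiveModNGaloisRep 3 := by
  haveI := isElliptic_17a1
  haveI := isGloballyMinimal_17a1
  haveI : Fact (Nat.Prime 5) := ⟨by norm_num⟩
  haveI : Fact (Nat.Prime 19) := ⟨by norm_num⟩
  exact hasSurjectiveModNGaloisRep_of_intModel_of_irr_of_order integralModelInt_17a1 3 5 19
    (by norm_num) (by norm_num) (by rw [M17_Δ]; decide) (by rw [M17_Δ]; decide)
    card_17a1_mod5 card_17a1_mod19 (by decide) (by decide) (by decide) (by decide)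

/-- `K` of discriminant `−35` satisfies the Heegner hypothesis for `51 = 3·17` (`(−35/3) = (−35/17) = 1`),
hence for `17`, and `3` splits in `K`. [cite: GrossLMS1991, §1 (p. 235)] -/
theorem heegner_51_of_discr_neg35 {K : Type} [Field K] [NumberField K] (hK : IsImaginaryQuadratic K)
    (hd : NumberField.discr K = -35) : SatisfiesHeegnerHypothesis 51 K := by
  rw [satisfiesHeegnerHypothesis_iff_kronecker 51 K hK.1, hd]
  intro p hp hpN
  have hp' : p = 3 ∨ p = 17 := by
    rcases (Nat.Prime.dvd_mul hp).mp (show p ∣ 3 * 17 from hpN) with h | h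
    · exact Or.inl ((Nat.prime_dvd_prime_iff_eq hp Nat.prime_three).mp h)
    · exact Or.inr ((Nat.prime_dvd_prime_iff_eq hp (by norm_num)).mp h)
  rcases hp' with rfl | rfl
  · exact ⟨fun h ↦ absurd h (by norm_num), fun _ ↦ by norm_num⟩
  · exact ⟨fun h ↦ absurd h (by norm_num), fun _ ↦ by norm_num⟩

/-- **BUCKET-C₀ HABITAT of `TwinAlgMuZeroAtThree`.** Every hypothesis of the crux other than the
binder `Dt'` is met simultaneously, in the kernel, on the good-supersingular branch: `E' = 17a1`
(`a₃ = 0`, `ρ̄₃` onto, `N = 17`), `K` of discriminant `−35` (Heegner for `17` and `3` split, odd),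
with `κ, γ, 𝔭, 𝔭'` as in the bucket-B habitat. [cite: CremonaAlgorithms1997, Table 1 (curve 17a1)] -/
theorem exists_bucketC0_antecedents :
    ∃ (W' : WeierstrassCurve ℚ) (_ : W'.IsElliptic) (_ : W'.IsGloballyMinimal)
      (K : Type) (_ : Field K) (_ : NumberField K)
      (κ : ZpExtension K 3) (γ : Field.absoluteGaloisGroup K)
      (𝔭 𝔭' : HeightOneSpectrum (𝓞 K)),
      (GoodSS W' 3 ∧ W'.frobeniusTrace 3 = 0) ∧
      W'.HasSurjectiveModNGaloisRep 3 ∧ W'.conductorNorm ℤ = 17 ∧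
      IsImaginaryQuadratic K ∧ SatisfiesHeegnerHypothesis 17 K ∧ Odd (NumberField.discr K) ∧
      κ.IsAnticyclotomic ∧ κ.IsTopGenerator γ ∧
      ((3 : ℕ) : 𝓞 K) ∈ 𝔭.asIdeal ∧ 𝔭.asIdeal.ramificationIdx (𝓞 ℚ) = 1 ∧
      𝔭.asIdeal.inertiaDeg (𝓞 ℚ) = 1 ∧ ((3 : ℕ) : 𝓞 K) ∈ 𝔭'.asIdeal ∧ 𝔭' ≠ 𝔭 := by
  -- the field: `d = −35 ≡ 1 (mod 4)` squarefree (Marcus Ch. 2 Thm. 1)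
  obtain ⟨K, _, _, hK2, hd⟩ :=
    Literature.NumberTheory.QuadraticFields.Quadratic.exists_numberField_discr_eq (D := -35)
      (Or.inl ⟨by norm_num, Int.squarefree_natAbs.mp (by decide +kernel), by norm_num⟩)
  have hK : IsImaginaryQuadratic K := isImaginaryQuadratic_iff_discr_neg.2 ⟨hK2, by rw [hd]; norm_num⟩
  have hH : SatisfiesHeegnerHypothesis 51 K := heegner_51_of_discr_neg35 hK hd
  obtain ⟨κ, γ, -, hκ, hγ, -⟩ := exists_anticyclotomic_generator_prime (p := 3) hK
  obtain ⟨𝔭, 𝔭', h𝔭, he, hf, h𝔭', hne⟩ :=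
    exists_two_primes_of_splitsIn hK.1 (splitsIn_three_of_heegner (by norm_num) hH)
  haveI := isElliptic_17a1
  haveI := isGloballyMinimal_17a1
  exact ⟨_, isElliptic_17a1, isGloballyMinimal_17a1, K, _, _, κ, γ, 𝔭, 𝔭',
    goodSS_three_17a1, surj_three_17a1, conductorNorm_17a1,
    hK, hH.of_dvd (by norm_num), by rw [hd]; decide, hκ, hγ, h𝔭, he, hf, h𝔭', hne⟩

end Summit.BirchSwinnertonDyer.BirchSwinnertonDyer.Theorems.TwinAlgMuZeroAtThree.Negative

end
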